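import Mathlib
import Summits.AtomisticToContinuum.Crystallization.Theorems.GappedShellCensusCleanLimitsHaveWindowsDefs

/-!
# Zero transversal defect at a gapped-twelve site ⇒ exactly layered bond shell

Crux `GappedShellCensus.CleanLimitsHaveWindows` (stmt-AtomisticToContinuum-15932), line `Sketch`, stub
`stub_exactShellOfDefectZero` (T3a-i). If the bond shell of `p` has exactly twelve points, all in the radial
band `[0.98a, 1.02a]`, and the transversal defect `localDefect a Z p` vanishes, then the bond shell IS the
image of a cubic- or hexagonal-type slot model `slotC a' h⁺ h⁻` / `slotH a' h⁺ h⁻` (`a', h⁺, h⁻ > 0`) under a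
linear isometry of `ℝ³` followed by the translation by `p`.

Proof. (1) Attainment: the labellings `↥(bondShell a Z p) ≃ Fin 12` form a finite non-empty type and the
parameter box is compact, the misfit is continuous, so the double infimum is a minimum, which is `0`.
(2) A vanishing misfit (a sum of squares) forces equality of all radial and mutual distances, hence (by
polarisation) equality of the Gram matrices of `q k - p` and `slot k`. (3) The slots `0, 2, 6` are a basis of
`ℝ³` (`a' ≠ 0`, `h⁺ ≠ 0`, the latter from the radial band); the linear map sending them to the corresponding
`q k - p` preserves the Gram matrix of a basis, hence is a linear isometry, and it sends every slot to the
corresponding `q k - p` because a vector is determined by its inner products with a basis.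
-/

noncomputable section

namespace Summit.AtomisticToContinuum.Crystallization.Theorems.CleanHull

open Literature.MathematicalPhysics.StatisticalMechanics

/-! ## The slot models: linearity in the parameters, continuity, norms, independence -/

/-- The cubic slot model is linear in `(a', h⁺, h⁻)`. [folklore] -/
theorem slotC_eq_smul (a' hp hm : ℝ) :
    slotC a' hp hm = a' • slotC 1 0 0 + hp • slotC 0 1 0 + hm • slotC 0 0 1 := by
  ext k i
  fin_cases k <;> fin_cases i <;>
    simp [slotC, triangularVec₁, triangularVec₂, barlowOffset, layerNormal] <;> ring

/-- The hexagonal slot model is linear in `(a', h⁺, h⁻)`. [folklore] -/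
theorem slotH_eq_smul (a' hp hm : ℝ) :
    slotH a' hp hm = a' • slotH 1 0 0 + hp • slotH 0 1 0 + hm • slotH 0 0 1 := by
  ext k i
  fin_cases k <;> fin_cases i <;>
    simp [slotH, triangularVec₁, triangularVec₂, barlowOffset, layerNormal] <;> ring

/-- The cluster misfit against a continuously varying slot model is continuous. [folklore] -/
theorem continuous_clusterMisfit_comp {X : Type*} [TopologicalSpace X] (p : EuclideanSpace ℝ (Fin 3))
    (q : Fin 12 → EuclideanSpace ℝ (Fin 3)) {s : X → Fin 12 → EuclideanSpace ℝ (Fin 3)}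
    (hs : Continuous s) : Continuous fun x => clusterMisfit p q (s x) := by
  unfold clusterMisfit
  have hk : ∀ k, Continuous fun x => s x k := fun k => (continuous_apply k).comp hs
  fun_prop

/-- Continuity of the cubic-type misfit in the parameters. [folklore] -/
theorem continuous_clusterMisfit_slotC (p : EuclideanSpace ℝ (Fin 3))
    (q : Fin 12 → EuclideanSpace ℝ (Fin 3)) :
    Continuous fun θ : ℝ × ℝ × ℝ => clusterMisfit p q (slotC θ.1 θ.2.1 θ.2.2) := by
  refine continuous_clusterMisfit_comp p q (s := fun θ : ℝ × ℝ × ℝ => slotC θ.1 θ.2.1 θ.2.2) ?_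
  rw [show (fun θ : ℝ × ℝ × ℝ => slotC θ.1 θ.2.1 θ.2.2) =
      fun θ => θ.1 • slotC 1 0 0 + θ.2.1 • slotC 0 1 0 + θ.2.2 • slotC 0 0 1 from
    funext fun θ => slotC_eq_smul _ _ _]
  fun_prop

/-- Continuity of the hexagonal-type misfit in the parameters. [folklore] -/
theorem continuous_clusterMisfit_slotH (p : EuclideanSpace ℝ (Fin 3))
    (q : Fin 12 → EuclideanSpace ℝ (Fin 3)) :
    Continuous fun θ : ℝ × ℝ × ℝ => clusterMisfit p q (slotH θ.1 θ.2.1 θ.2.2) := by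
  refine continuous_clusterMisfit_comp p q (s := fun θ : ℝ × ℝ × ℝ => slotH θ.1 θ.2.1 θ.2.2) ?_
  rw [show (fun θ : ℝ × ℝ × ℝ => slotH θ.1 θ.2.1 θ.2.2) =
      fun θ => θ.1 • slotH 1 0 0 + θ.2.1 • slotH 0 1 0 + θ.2.2 • slotH 0 0 1 from
    funext fun θ => slotH_eq_smul _ _ _]
  fun_prop

/-- The cubic and hexagonal slot models agree at the labels `0, 2, 6` (in-plane `u`, `v` and the upper
`h⁺e₃ + w`). [folklore] -/
theorem slotH_eq_slotC_of (a' hp hm : ℝ) :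
    slotH a' hp hm 0 = slotC a' hp hm 0 ∧ slotH a' hp hm 2 = slotC a' hp hm 2 ∧
      slotH a' hp hm 6 = slotC a' hp hm 6 := by
  simp [slotC, slotH]

/-- `‖slot 0‖ = |a'|`. [folklore] -/
theorem norm_slotC_zero (a' hp hm : ℝ) : ‖slotC a' hp hm 0‖ = |a'| := by
  rw [EuclideanSpace.norm_eq]
  simp [slotC, triangularVec₁, Fin.sum_univ_three, Real.sqrt_sq_eq_abs]

/-- `‖slot 6‖² = h⁺² + a'²/3`. [folklore] -/
theorem norm_sq_slotC_six (a' hp hm : ℝ) : ‖slotC a' hp hm 6‖ ^ 2 = hp ^ 2 + a' ^ 2 / 3 := by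
  rw [EuclideanSpace.norm_sq_eq]
  simp [slotC, barlowOffset, layerNormal, Fin.sum_univ_three]
  have h3 : Real.sqrt 3 ^ 2 = 3 := Real.sq_sqrt (by norm_num)
  nlinarith [h3]

/-- `‖slot 9‖² = h⁻² + a'²/3` (cubic type). [folklore] -/
theorem norm_sq_slotC_nine (a' hp hm : ℝ) : ‖slotC a' hp hm 9‖ ^ 2 = hm ^ 2 + a' ^ 2 / 3 := by
  rw [EuclideanSpace.norm_sq_eq]
  simp [slotC, barlowOffset, layerNormal, Fin.sum_univ_three]
  have h3 : Real.sqrt 3 ^ 2 = 3 := Real.sq_sqrt (by norm_num)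
  nlinarith [h3]

/-- `‖slot 9‖² = h⁻² + a'²/3` (hexagonal type). [folklore] -/
theorem norm_sq_slotH_nine (a' hp hm : ℝ) : ‖slotH a' hp hm 9‖ ^ 2 = hm ^ 2 + a' ^ 2 / 3 := by
  rw [EuclideanSpace.norm_sq_eq]
  simp [slotH, barlowOffset, layerNormal, Fin.sum_univ_three]
  have h3 : Real.sqrt 3 ^ 2 = 3 := Real.sq_sqrt (by norm_num)
  nlinarith [h3]

/-- The slots `0, 2, 6` (`u`, `v`, `h⁺e₃ + w`) are linearly independent when `a' ≠ 0 ≠ h⁺`. [folklore] -/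
theorem linearIndependent_slotC (a' hp hm : ℝ) (ha : a' ≠ 0) (hh : hp ≠ 0) :
    LinearIndependent ℝ ![slotC a' hp hm 0, slotC a' hp hm 2, slotC a' hp hm 6] := by
  rw [Fintype.linearIndependent_iff]
  intro g hg
  have h0 := congr_fun (congrArg (⇑) hg) 0
  have h1 := congr_fun (congrArg (⇑) hg) 1
  have h2 := congr_fun (congrArg (⇑) hg) 2
  simp [Fin.sum_univ_three, slotC, triangularVec₁, triangularVec₂, barlowOffset, layerNormal] at h0 h1 h2
  have g2 : g 2 = 0 := h2.resolve_right hh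
  have h3 : Real.sqrt 3 ≠ 0 := by positivity
  have g1 : g 1 = 0 := by
    rw [g2, zero_mul, add_zero] at h1
    rcases mul_eq_zero.mp h1 with h | h
    · exact h
    · exfalso; exact (mul_ne_zero (mul_ne_zero ha h3) (by norm_num : (2 : ℝ)⁻¹ ≠ 0)) (by
        simpa [div_eq_mul_inv] using h)
  have g0 : g 0 = 0 := by
    rw [g1, g2, zero_mul, add_zero, add_zero] at h0
    exact (mul_eq_zero.mp h0).resolve_right ha
  intro i
  fin_cases i <;> assumption

/-! ## Zero misfit ⇒ equal distance data ⇒ equal Gram matrices ⇒ linear isometry -/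

/-- A vanishing misfit forces equality of all radial and all mutual distances. [folklore] -/
theorem dist_eq_of_clusterMisfit_eq_zero {p : EuclideanSpace ℝ (Fin 3)}
    {q slot : Fin 12 → EuclideanSpace ℝ (Fin 3)} (h : clusterMisfit p q slot = 0) :
    (∀ k, dist (q k) p = ‖slot k‖) ∧ ∀ k l, dist (q k) (q l) = dist (slot k) (slot l) := by
  unfold clusterMisfit at h
  rw [add_eq_zero_iff_of_nonneg (Finset.sum_nonneg fun _ _ => sq_nonneg _)
    (Finset.sum_nonneg fun _ _ => Finset.sum_nonneg fun _ _ => sq_nonneg _)] at h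
  obtain ⟨h1, h2⟩ := h
  rw [Finset.sum_eq_zero_iff_of_nonneg fun _ _ => sq_nonneg _] at h1
  rw [Finset.sum_eq_zero_iff_of_nonneg fun _ _ => Finset.sum_nonneg fun _ _ => sq_nonneg _] at h2
  refine ⟨fun k => sub_eq_zero.mp ((pow_eq_zero_iff two_ne_zero).mp (h1 k (Finset.mem_univ _))),
    fun k l => sub_eq_zero.mp ((pow_eq_zero_iff two_ne_zero).mp ?_)⟩
  exact (Finset.sum_eq_zero_iff_of_nonneg fun _ _ => sq_nonneg _).mp (h2 k (Finset.mem_univ _)) l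
    (Finset.mem_univ _)

/-- A vanishing misfit forces equality of the Gram matrices of `q k - p` and `slot k` (polarisation).
[folklore] -/
theorem inner_eq_of_clusterMisfit_eq_zero {p : EuclideanSpace ℝ (Fin 3)}
    {q slot : Fin 12 → EuclideanSpace ℝ (Fin 3)} (h : clusterMisfit p q slot = 0) (k l : Fin 12) :
    inner ℝ (q k - p) (q l - p) = inner ℝ (slot k) (slot l) := by
  obtain ⟨h1, h2⟩ := dist_eq_of_clusterMisfit_eq_zero h
  simp only [dist_eq_norm] at h1 h2
  rw [real_inner_eq_norm_mul_self_add_norm_mul_self_sub_norm_sub_mul_self_div_two,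
    real_inner_eq_norm_mul_self_add_norm_mul_self_sub_norm_sub_mul_self_div_two,
    sub_sub_sub_cancel_right, h1, h1, h2]

/-- **Congruent frames extend to a linear isometry.** Two `Fin 12`-families in `ℝ³` with equal Gram
matrices, the second containing a basis at the labels `0, 2, 6`, differ by a linear isometry. [folklore] -/
theorem exists_linearIsometry_of_inner_eq {x y : Fin 12 → EuclideanSpace ℝ (Fin 3)}
    (h : ∀ k l, inner ℝ (x k) (x l) = inner ℝ (y k) (y l))
    (hli : LinearIndependent ℝ ![y 0, y 2, y 6]) :
    ∃ A : EuclideanSpace ℝ (Fin 3) →ₗᵢ[ℝ] EuclideanSpace ℝ (Fin 3), ∀ k, A (y k) = x k := by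
  classical
  let idx : Fin 3 → Fin 12 := ![0, 2, 6]
  have hyi : ∀ i, (![y 0, y 2, y 6] : Fin 3 → EuclideanSpace ℝ (Fin 3)) i = y (idx i) := fun i => by
    fin_cases i <;> rfl
  let b : Module.Basis (Fin 3) ℝ (EuclideanSpace ℝ (Fin 3)) :=
    basisOfLinearIndependentOfCardEqFinrank hli (by simp)
  have hb : ∀ i, b i = y (idx i) := fun i => by
    rw [← hyi]; exact congr_fun (coe_basisOfLinearIndependentOfCardEqFinrank hli _) i
  let B : EuclideanSpace ℝ (Fin 3) →ₗ[ℝ] EuclideanSpace ℝ (Fin 3) := b.constr ℝ fun i => x (idx i)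
  have hB : ∀ i, B (b i) = x (idx i) := fun i => b.constr_basis ℝ _ i
  have hBB : ∀ v w, inner ℝ (B v) (B w) = inner ℝ v w := by
    have key : (innerₗ (EuclideanSpace ℝ (Fin 3))).compl₁₂ B B = innerₗ (EuclideanSpace ℝ (Fin 3)) :=
      LinearMap.ext_basis b b fun i j => by
        rw [LinearMap.compl₁₂_apply, innerₗ_apply_apply, innerₗ_apply_apply, hB, hB, hb, hb, h]
    intro v w
    simpa using LinearMap.congr_fun₂ key v w
  let A : EuclideanSpace ℝ (Fin 3) →ₗᵢ[ℝ] EuclideanSpace ℝ (Fin 3) := B.isometryOfInner hBB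
  have hA : ∀ i, A (b i) = x (idx i) := hB
  let b' : Module.Basis (Fin 3) ℝ (EuclideanSpace ℝ (Fin 3)) :=
    b.map (A.toLinearIsometryEquiv rfl).toLinearEquiv
  have hb' : ∀ i, b' i = x (idx i) := fun i => by
    simp [b', Module.Basis.map_apply, hA]
  refine ⟨A, fun k => InnerProductSpace.ext_inner_left_basis b' fun i => ?_⟩
  rw [hb']
  calc inner ℝ (x (idx i)) (A (y k)) = inner ℝ (A (b i)) (A (y k)) := by rw [hA]
    _ = inner ℝ (b i) (y k) := A.inner_map_map _ _
    _ = inner ℝ (y (idx i)) (y k) := by rw [hb]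
    _ = inner ℝ (x (idx i)) (x k) := (h _ _).symm

/-- A labelled shell with zero misfit against a slot model whose slots `0, 2, 6` are independent is the
image of the slot model under a linear isometry followed by translation by the centre. [folklore] -/
theorem shell_eq_range_of_clusterMisfit_eq_zero {S : Set (EuclideanSpace ℝ (Fin 3))}
    {p : EuclideanSpace ℝ (Fin 3)} (e : ↥S ≃ Fin 12) {slot : Fin 12 → EuclideanSpace ℝ (Fin 3)}
    (h : clusterMisfit p (fun k => (e.symm k : EuclideanSpace ℝ (Fin 3))) slot = 0)
    (hli : LinearIndependent ℝ ![slot 0, slot 2, slot 6]) :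
    ∃ A : EuclideanSpace ℝ (Fin 3) →ₗᵢ[ℝ] EuclideanSpace ℝ (Fin 3),
      S = Set.range fun k : Fin 12 => p + A (slot k) := by
  obtain ⟨A, hA⟩ := exists_linearIsometry_of_inner_eq
    (x := fun k => (e.symm k : EuclideanSpace ℝ (Fin 3)) - p) (y := slot)
    (fun k l => inner_eq_of_clusterMisfit_eq_zero h k l) hli
  refine ⟨A, Set.ext fun w => ⟨fun hw => ⟨e ⟨w, hw⟩, ?_⟩, ?_⟩⟩
  · simp [hA]
  · rintro ⟨k, rfl⟩
    simp only [hA, add_sub_cancel]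
    exact (e.symm k).2

/-! ## Attainment of the transversal defect -/

/-- For a fixed labelled cluster, the infimum over the compact parameter box of the (continuous) two-type
misfit is attained. [folklore] -/
theorem exists_param_isMin (a : ℝ) (ha : 0 < a) (p : EuclideanSpace ℝ (Fin 3))
    (q : Fin 12 → EuclideanSpace ℝ (Fin 3)) :
    ∃ θ₀ : ℝ × ℝ × ℝ, (a / 2 ≤ θ₀.1 ∧ θ₀.1 ≤ 2 * a ∧ 0 ≤ θ₀.2.1 ∧ θ₀.2.1 ≤ 2 * a ∧
        0 ≤ θ₀.2.2 ∧ θ₀.2.2 ≤ 2 * a) ∧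
      (⨅ θ : {θ : ℝ × ℝ × ℝ // a / 2 ≤ θ.1 ∧ θ.1 ≤ 2 * a ∧ 0 ≤ θ.2.1 ∧ θ.2.1 ≤ 2 * a ∧
          0 ≤ θ.2.2 ∧ θ.2.2 ≤ 2 * a},
        min (clusterMisfit p q (slotC θ.1.1 θ.1.2.1 θ.1.2.2))
          (clusterMisfit p q (slotH θ.1.1 θ.1.2.1 θ.1.2.2))) =
      min (clusterMisfit p q (slotC θ₀.1 θ₀.2.1 θ₀.2.2))
        (clusterMisfit p q (slotH θ₀.1 θ₀.2.1 θ₀.2.2)) := by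
  let box : Set (ℝ × ℝ × ℝ) := Set.Icc (a / 2) (2 * a) ×ˢ (Set.Icc 0 (2 * a) ×ˢ Set.Icc 0 (2 * a))
  have hmem : ∀ θ : ℝ × ℝ × ℝ, θ ∈ box ↔ (a / 2 ≤ θ.1 ∧ θ.1 ≤ 2 * a ∧ 0 ≤ θ.2.1 ∧ θ.2.1 ≤ 2 * a ∧
      0 ≤ θ.2.2 ∧ θ.2.2 ≤ 2 * a) := fun θ => by
    simp only [box, Set.mem_prod, Set.mem_Icc, and_assoc]
  have hcpt : IsCompact box := isCompact_Icc.prod (isCompact_Icc.prod isCompact_Icc)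
  have hne : box.Nonempty :=
    ⟨(a, a, a), (hmem _).2 ⟨by linarith, by linarith, ha.le, by linarith, ha.le, by linarith⟩⟩
  have hgc : Continuous fun θ : ℝ × ℝ × ℝ => min (clusterMisfit p q (slotC θ.1 θ.2.1 θ.2.2))
      (clusterMisfit p q (slotH θ.1 θ.2.1 θ.2.2)) :=
    (continuous_clusterMisfit_slotC p q).min (continuous_clusterMisfit_slotH p q)
  obtain ⟨θ₀, hθ₀, hmin⟩ := hcpt.exists_isMinOn hne hgc.continuousOn
  have hθ₀' := (hmem θ₀).1 hθ₀
  refine ⟨θ₀, hθ₀', le_antisymm ?_ ?_⟩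
  · have hbdd : BddBelow (Set.range fun θ : {θ : ℝ × ℝ × ℝ // a / 2 ≤ θ.1 ∧ θ.1 ≤ 2 * a ∧ 0 ≤ θ.2.1 ∧
        θ.2.1 ≤ 2 * a ∧ 0 ≤ θ.2.2 ∧ θ.2.2 ≤ 2 * a} =>
        min (clusterMisfit p q (slotC θ.1.1 θ.1.2.1 θ.1.2.2))
          (clusterMisfit p q (slotH θ.1.1 θ.1.2.1 θ.1.2.2))) := by
      refine ⟨0, ?_⟩
      rintro _ ⟨θ, rfl⟩
      exact le_min (clusterMisfit_nonneg _ _ _) (clusterMisfit_nonneg _ _ _)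
    exact ciInf_le hbdd ⟨θ₀, hθ₀'⟩
  · haveI : Nonempty {θ : ℝ × ℝ × ℝ // a / 2 ≤ θ.1 ∧ θ.1 ≤ 2 * a ∧ 0 ≤ θ.2.1 ∧ θ.2.1 ≤ 2 * a ∧
        0 ≤ θ.2.2 ∧ θ.2.2 ≤ 2 * a} := ⟨⟨θ₀, hθ₀'⟩⟩
    exact le_ciInf fun θ => (isMinOn_iff.mp hmin) θ.1 ((hmem θ.1).2 θ.2)

/-- If the bond shell has twelve points and the transversal defect vanishes, some labelling and some
parameters in the box realise zero misfit (finite labelling type, compact box, continuous misfit).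
[folklore] -/
theorem exists_clusterMisfit_eq_zero (a : ℝ) (Z : Set (EuclideanSpace ℝ (Fin 3)))
    (p : EuclideanSpace ℝ (Fin 3)) (ha : 0 < a) (hS : (bondShell a Z p).ncard = 12)
    (hd : localDefect a Z p = 0) :
    ∃ (e : ↥(bondShell a Z p) ≃ Fin 12) (a' hp hm : ℝ), a / 2 ≤ a' ∧ 0 ≤ hp ∧ 0 ≤ hm ∧
      (clusterMisfit p (fun k => (e.symm k : EuclideanSpace ℝ (Fin 3))) (slotC a' hp hm) = 0 ∨
        clusterMisfit p (fun k => (e.symm k : EuclideanSpace ℝ (Fin 3))) (slotH a' hp hm) = 0) := by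
  have hfin : (bondShell a Z p).Finite := Set.finite_of_ncard_ne_zero (by omega)
  haveI := hfin.to_subtype
  have hcard : Nat.card ↥(bondShell a Z p) = 12 := by rw [Nat.card_coe_set_eq]; exact hS
  haveI : Nonempty (↥(bondShell a Z p) ≃ Fin 12) := ⟨Finite.equivFinOfCardEq hcard⟩
  obtain ⟨e, he⟩ := exists_eq_ciInf_of_finite (f := fun e : ↥(bondShell a Z p) ≃ Fin 12 =>
    ⨅ θ : {θ : ℝ × ℝ × ℝ // a / 2 ≤ θ.1 ∧ θ.1 ≤ 2 * a ∧ 0 ≤ θ.2.1 ∧ θ.2.1 ≤ 2 * a ∧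
        0 ≤ θ.2.2 ∧ θ.2.2 ≤ 2 * a},
      min (clusterMisfit p (fun k => (e.symm k : EuclideanSpace ℝ (Fin 3)))
          (slotC θ.1.1 θ.1.2.1 θ.1.2.2))
        (clusterMisfit p (fun k => (e.symm k : EuclideanSpace ℝ (Fin 3)))
          (slotH θ.1.1 θ.1.2.1 θ.1.2.2)))
  obtain ⟨θ₀, hθ₀, hinf⟩ := exists_param_isMin a ha p fun k => (e.symm k : EuclideanSpace ℝ (Fin 3))
  have hval : min (clusterMisfit p (fun k => (e.symm k : EuclideanSpace ℝ (Fin 3)))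
        (slotC θ₀.1 θ₀.2.1 θ₀.2.2))
      (clusterMisfit p (fun k => (e.symm k : EuclideanSpace ℝ (Fin 3)))
        (slotH θ₀.1 θ₀.2.1 θ₀.2.2)) = 0 := by
    rw [← hinf]; exact he.trans hd
  refine ⟨e, θ₀.1, θ₀.2.1, θ₀.2.2, hθ₀.1, hθ₀.2.2.1, hθ₀.2.2.2.2.1, ?_⟩
  rcases min_eq_iff.mp hval with ⟨h, -⟩ | ⟨h, -⟩
  · exact Or.inl h
  · exact Or.inr h

/-- Positivity of a free height from the radial band: `‖slot 0‖ = |a'| ≤ 1.02a` and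
`0.98a ≤ ‖slot 6‖ = √(h² + a'²/3)` force `h ≠ 0`. [folklore] -/
theorem height_pos_of_band {a a' h r0 r6 : ℝ} (ha : 0 < a) (hh : 0 ≤ h) (h0 : r0 = |a'|)
    (h6 : r6 ^ 2 = h ^ 2 + a' ^ 2 / 3) (b0 : r0 ≤ a * (1 + 1 / 50)) (b6 : a * (1 - 1 / 50) ≤ r6) :
    0 < h := by
  have e6 : (a * (1 - 1 / 50)) ^ 2 ≤ r6 ^ 2 := pow_le_pow_left₀ (by linarith) b6 2
  have e0 : a' ^ 2 ≤ (a * (1 + 1 / 50)) ^ 2 := by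
    rw [← sq_abs, ← h0]; exact pow_le_pow_left₀ (h0 ▸ abs_nonneg _) b0 2
  rcases hh.lt_or_eq with hlt | heq
  · exact hlt
  · exfalso; rw [← heq] at h6; nlinarith [mul_pos ha ha]

/-- **Stub T3a-i (zero defect ⇒ exactly layered shell).** At a gapped-twelve site `p` of `Z` with vanishing
transversal defect, the bond shell of `p` is the image of a cubic- or hexagonal-type slot model with positive
spacing and positive free heights under a linear isometry followed by the translation by `p`. [folklore] -/
theorem stub_exactShellOfDefectZero (Z : Set (EuclideanSpace ℝ (Fin 3))) (a : ℝ) (ha : 0 < a)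
    (p : EuclideanSpace ℝ (Fin 3)) (hp : p ∈ Z)
    (hgap : {w ∈ Z | w ≠ p ∧ dist p w ≤ a * (1 + 1 / 50)}.ncard = 12 ∧
      ∀ w ∈ Z, w ≠ p → a * (1 - 1 / 50) ≤ dist p w ∧ (dist p w ≤ a * (1 + 1 / 50) ∨ a * (63 / 50) ≤ dist p w))
    (hd : localDefect a Z p = 0) :
    ∃ (a' hp' hm' : ℝ) (A : EuclideanSpace ℝ (Fin 3) →ₗᵢ[ℝ] EuclideanSpace ℝ (Fin 3)), 0 < a' ∧ 0 < hp' ∧ 0 < hm' ∧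
      ((bondShell a Z p = Set.range fun k : Fin 12 => p + A (slotC a' hp' hm' k)) ∨
       (bondShell a Z p = Set.range fun k : Fin 12 => p + A (slotH a' hp' hm' k))) := by
  have _ := hp -- `p ∈ Z` is part of the registered signature but not needed
  obtain ⟨e, a', hp', hm', ha', hhp, hhm, hzero⟩ := exists_clusterMisfit_eq_zero a Z p ha hgap.1 hd
  have band : ∀ k, a * (1 - 1 / 50) ≤ dist ((e.symm k : EuclideanSpace ℝ (Fin 3))) p ∧
      dist ((e.symm k : EuclideanSpace ℝ (Fin 3))) p ≤ a * (1 + 1 / 50) := fun k => by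
    obtain ⟨hZ, hne, hle⟩ := (e.symm k).2
    rw [dist_comm]; exact ⟨(hgap.2 _ hZ hne).1, hle⟩
  have ha'0 : 0 < a' := by linarith
  obtain ⟨e0, e2, e6⟩ := slotH_eq_slotC_of a' hp' hm'
  rcases hzero with h0 | h0
  · obtain ⟨h1, -⟩ := dist_eq_of_clusterMisfit_eq_zero h0
    have hp0 : 0 < hp' := height_pos_of_band ha hhp ((h1 0).trans (norm_slotC_zero a' hp' hm'))
      (by rw [h1 6]; exact norm_sq_slotC_six a' hp' hm') (band 0).2 (band 6).1
    have hm0 : 0 < hm' := height_pos_of_band ha hhm ((h1 0).trans (norm_slotC_zero a' hp' hm'))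
      (by rw [h1 9]; exact norm_sq_slotC_nine a' hp' hm') (band 0).2 (band 9).1
    obtain ⟨A, hA⟩ := shell_eq_range_of_clusterMisfit_eq_zero e h0
      (linearIndependent_slotC a' hp' hm' ha'0.ne' hp0.ne')
    exact ⟨a', hp', hm', A, ha'0, hp0, hm0, Or.inl hA⟩
  · obtain ⟨h1, -⟩ := dist_eq_of_clusterMisfit_eq_zero h0
    have r0 : dist ((e.symm 0 : EuclideanSpace ℝ (Fin 3))) p = |a'| := by
      rw [h1 0, e0]; exact norm_slotC_zero a' hp' hm'
    have hp0 : 0 < hp' := height_pos_of_band ha hhp r0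
      (by rw [h1 6, e6]; exact norm_sq_slotC_six a' hp' hm') (band 0).2 (band 6).1
    have hm0 : 0 < hm' := height_pos_of_band ha hhm r0
      (by rw [h1 9]; exact norm_sq_slotH_nine a' hp' hm') (band 0).2 (band 9).1
    obtain ⟨A, hA⟩ := shell_eq_range_of_clusterMisfit_eq_zero e h0
      (by rw [e0, e2, e6]; exact linearIndependent_slotC a' hp' hm' ha'0.ne' hp0.ne')
    exact ⟨a', hp', hm', A, ha'0, hp0, hm0, Or.inr hA⟩

end Summit.AtomisticToContinuum.Crystallization.Theorems.CleanHull

end
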